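import Literature.NumberTheory.Automorphic.KimExteriorSquareGL4ArchimedeanTwist
import Literature.NumberTheory.Automorphic.AutomorphicRepsGLCleanModelArch
import Literature.NumberTheory.Automorphic.AutomorphicRepDataSplitCenter
import Literature.NumberTheory.Automorphic.AutomorphicRepsGLCuspidalUnitaryHolds
import HarnessLib

/-!
# Kim's exterior square `GL₄ → GL₆`, archimedean clause: unconditional reduction of the fact to
# Kim's printed hypothesis (clean cuspidal data with unitary central character on `A_G`)

Sibling proof file (theorems only; no `sorry`, no definition, no named fact) of
`Literature.NumberTheory.Automorphic.KimExteriorSquareGL4Archimedean`, whose named fact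
`Kim2003_exteriorSquare_GL4_archimedean` renders H. H. Kim, *Functoriality for the exterior square
of `GL₄` and the symmetric fourth of `GL₂`*, J. Amer. Math. Soc. **16** (2003) 139–183 [Kim2002],
Theorem A (p. 139) = Thm. 5.3.1 (p. 165) with its archimedean clause. It is the archimedean
companion of `KimExteriorSquareGL4Reduction` (Satake clauses, reduction to clean `A_G`-invariant
data granted semisimplicity) and the sequel of `KimExteriorSquareGL4ArchimedeanTwist` (twist
invariance of all three clauses; reduction to data with purely imaginary central exponent read on
the archimedean parameter).

Kim's standing convention (p. 139): *"In what follows, a cuspidal representation always means a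
unitary one."* The tree's fact quantifies over **every** cuspidal Borel–Jacquet datum `π = W / W'`
on `GL₄(𝔸_F)` (`W'` arbitrary, no condition on the split component `A_G = ℝ_{>0}` of the centre).
This file PROVES, now **unconditionally**, that the fact follows from its case of the data of Kim's
statement:

* `mulChar_detTwist_apply_posRealScalar_mul_of_cpow_of_eq` — `A_G` acts on the norm twist
  `|det|_𝔸^s · φ` by `a ↦ a^{μ + n[K:ℚ]s}` when it acts on `φ` by `a ↦ a^μ` (the general form of
  `mulChar_detTwist_apply_posRealScalar_mul_of_cpow`, which is the case `μ + n[K:ℚ]s = 0`).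
* `Kim2003_exteriorSquare_GL4_archimedean_of_clean_unitaryCentral` — **the fact follows from its
  case of clean (`W' = ⊥`) cuspidal data on which `A_G` acts by a unitary character**
  (`φ(a g) = a^μ φ(g)`, `Re μ = 0`): an irreducible `(𝔤, K_∞) × GL₄(𝔸_F^∞)`-stable space of cusp
  forms whose central character is unitary on `A_G` — the space of `K_∞`-finite vectors of a
  unitary cuspidal automorphic representation of `GL₄(𝔸_F)` in Kim's sense (Borel–Jacquet 1979,
  4.6, 5.7). Proof, assembling accepted results of the tree: by the semisimplicity of the space of
  `A_G`-invariant cusp forms — the named fact `AutomorphicRepsGL.stable_cuspidal_eq_sSup_irreducible`,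
  now PROVED (`AutomorphicRepsGL.stable_cuspidal_eq_sSup_irreducible_holds`, file
  `AutomorphicRepsGLCuspidalUnitaryHolds`; Gelfand–Piatetski-Shapiro, Borel–Jacquet 1979, 4.6) —
  every cuspidal `π` has a clean cuspidal model `π₀ = C / ⊥` with the Satake parameters AND the
  archimedean parameter of `π`
  (`CuspidalAutomorphicRepData.exists_clean_hasSatakeParamAt_hasArchParameter_of_sSup_irreducible`,
  file `AutomorphicRepsGLCleanModelArch`), so `π₀`, `π` are nearly equivalent
  (`hasSatakeParamAt_cofinite_holds`) with the archimedean parameters of `π` among those of `π₀`;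
  `A_G` acts on `π₀` by `a ↦ a^μ` (`AutomorphicRepData.exists_apply_posRealScalar_mul_eq_cpow`);
  the REAL norm twist `π₁ = π₀ ⊗ |det|_𝔸^s`, `s = -Re μ / 4[F:ℚ]`
  (`exists_heckeCharacter_ideleNorm_cpow`, `exists_cuspidalAutomorphicRepData_twist_hecke`) is clean
  and `A_G` acts on it by `a ↦ a^{i Im μ}`; the hypothesis gives the conclusion of Theorem A for
  `π₁`, which comes back to `π₀ = π₁ ⊗ |det|_𝔸^{-s}` by
  `Kim2003_exteriorSquare_GL4_archimedean.conclusion_of_twist_norm` (all three clauses; the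
  archimedean one by `∧²(χ - s) + 2s = ∧²χ`) and to `π` by
  `Kim2003_exteriorSquare_GL4_archimedean.conclusion_of_isNearlyEquivalent`.
  Borel–Jacquet 1979, 5.7 ("we may assume `π` unitary"); Kim 2003, p. 139.

Why `Re μ = 0` and not `μ = 0` (the normal form of `KimExteriorSquareGL4Reduction`): killing
`Im μ` takes the twist by the unitary character `|det|_𝔸^{it}`, whose effect on archimedean
parameters (`χ ↦ χ + it`) is not in the tree — `HasArchParameter.of_map_mulChar_detTwist`
(`ArchParameterTwistNorm`) and the shift homomorphisms of `HarishChandraGLTwist` are for real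
exponents (real linear forms on the real enveloping algebra). The class reached here is exactly
Kim's: unitary cuspidal representations, arbitrary unitary central character.

Nothing here assumes the fact; the discharge `Kim2003_exteriorSquare_GL4_archimedean_holds` is not
attempted (its printed proof, Thm. 5.3.1, rests on the weak lift Thm. 4.2.3 = the tree's unproved
`Kim2003_exteriorSquare_GL4`, the converse theorem and the Langlands–Shahidi method; see the module
docstring of `KimExteriorSquareGL4Proofs`, "Status of the discharge").

## References

* [Kim2002] H. H. Kim, J. Amer. Math. Soc. 16 (2003): §1 p. 139 (convention "cuspidal = unitary
  cuspidal"), Theorem A (p. 139), Thm. 5.3.1 (p. 165).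
* A. Borel, H. Jacquet, *Automorphic forms and automorphic representations*, Corvallis (1979),
  Part 1, §4.6 and 5.7 ("we may assume `π` unitary") [BorelJacquet1979],
  [BorelJacquetCorvallis1979].
* J. R. Getz, H. Hahn, *An Introduction to Automorphic Representations*, GTM 300 (2024), Thm. 6.5.1,
  Cor. 9.1.2 [GetzHahn2024].
-/

noncomputable section

open scoped MatrixGroups Classical NumberField NNReal
open NumberField IsDedekindDomain Filter
open Literature.NumberTheory.GaloisRepresentations (HeckeCharacter ideleGroup)

namespace Literature.NumberTheory.Automorphic

/-! ### `|det|_𝔸^s · φ` on the split component `A_G`, general exponent -/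

section SplitComponent

variable {n : ℕ} {K : Type} [Field K] [NumberField K]

/-- `(‖·‖^s)⁻¹ = ‖·‖^{-s}` (`s` real). [folklore] -/
private theorem inv_apply_eq_ideleNorm_cpow_neg' {χ : HeckeCharacter K} {s : ℝ}
    (hχ : ∀ x : ideleGroup K,
      ((χ x : ℂˣ) : ℂ) = (GaloisRepresentations.ideleNorm x : ℂ) ^ ((s : ℝ) : ℂ))
    (x : ideleGroup K) :
    ((χ⁻¹ x : ℂˣ) : ℂ) = (GaloisRepresentations.ideleNorm x : ℂ) ^ (((-s : ℝ) : ℝ) : ℂ) := by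
  rw [GaloisRepresentations.HeckeCharacter.inv_apply, Units.val_inv_eq_inv_val, hχ,
    Complex.ofReal_neg, Complex.cpow_neg]

/-- **`A_G` acts on `|det|_𝔸^s · φ` by `a ↦ a^{μ + n[K:ℚ]s}` when it acts on `φ` by `a ↦ a^μ`**
(`|det (a g)|_𝔸^s = (a^{n[K:ℚ]})^s |det g|_𝔸^s`, `detTwist_posRealScalar_of_cpow`): the general
form of `mulChar_detTwist_apply_posRealScalar_mul_of_cpow` (the case `ν = 0`). Borel–Jacquet 1979,
5.7. [cite: BorelJacquetCorvallis1979, 5.7] -/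
theorem mulChar_detTwist_apply_posRealScalar_mul_of_cpow_of_eq {χ : HeckeCharacter K} {s : ℂ}
    (hχ : ∀ x : ideleGroup K, ((χ x : ℂˣ) : ℂ) = (GaloisRepresentations.ideleNorm x : ℂ) ^ s)
    {μ ν : ℂ} (hν : ((n * Module.finrank ℚ K : ℕ) : ℂ) * s + μ = ν)
    {φ : (AdelicGroupData.gl n K).Adelic → ℂ}
    (hφ : ∀ (t : ℝ≥0ˣ) (g : (AdelicGroupData.gl n K).Adelic),
      φ ((show (AdelicGroupData.gl n K).Adelic from posRealScalar n K t) * g) =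
        (((t : ℝ≥0) : ℝ) : ℂ) ^ μ * φ g)
    (t : ℝ≥0ˣ) (g : (AdelicGroupData.gl n K).Adelic) :
    mulChar (detTwist n χ) φ ((show (AdelicGroupData.gl n K).Adelic from posRealScalar n K t) * g) =
      (((t : ℝ≥0) : ℝ) : ℂ) ^ ν * mulChar (detTwist n χ) φ g := by
  subst hν
  have ht : (0 : ℝ) < ((t : ℝ≥0) : ℝ) := NNReal.coe_pos.2 (pos_iff_ne_zero.2 t.ne_zero)
  have ht' : (((t : ℝ≥0) : ℝ) : ℂ) ≠ 0 := Complex.ofReal_ne_zero.2 ht.ne'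
  rw [mulChar_apply, mulChar_apply, map_mul, Units.val_mul, hφ t g]
  change ((detTwist n χ (posRealScalar n K t) : ℂˣ) : ℂ) * _ * _ = _
  rw [detTwist_posRealScalar_of_cpow hχ, ← Real.rpow_natCast, ← Complex.cpow_mul_ofReal_nonneg ht.le,
    Complex.cpow_add _ _ ht', Complex.ofReal_natCast]
  ring

end SplitComponent

/-! ### Reduction of the fact to clean cuspidal data with unitary central character on `A_G` -/

section Reduction

/-- **`Kim2003_exteriorSquare_GL4_archimedean` follows from its case of clean cuspidal data on
which `A_G` acts by a unitary character** (the tree's rendering "for every cuspidal Borel–Jacquet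
datum `π = W / W'`" reduced, unconditionally, to Kim's printed hypothesis "`π` a (unitary) cuspidal
automorphic representation of `GL₄(𝔸_F)`", p. 139). A clean (`W' = ⊥`) cuspidal datum on which the
split component `A_G = ℝ_{>0}` of the centre acts by `a ↦ a^μ` with `Re μ = 0` is an irreducible
`(𝔤, K_∞) × GL₄(𝔸_F^∞)`-stable space of cusp forms with unitary central character on `A_G`, i.e.
the space of `K_∞`-finite smooth vectors of a unitary cuspidal automorphic representation
(Borel–Jacquet 1979, 4.6). Proof: the semisimplicity of `A_G`-invariant cusp forms
(`AutomorphicRepsGL.stable_cuspidal_eq_sSup_irreducible_holds`) yields a clean cuspidal model `π₀`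
of `π` with the Satake parameters and the archimedean parameter of `π`
(`CuspidalAutomorphicRepData.exists_clean_hasSatakeParamAt_hasArchParameter_of_sSup_irreducible`),
nearly equivalent to `π` (`hasSatakeParamAt_cofinite_holds`); `A_G` acts on `π₀` by `a ↦ a^μ`
(`AutomorphicRepData.exists_apply_posRealScalar_mul_eq_cpow`); the real twist
`π₁ = π₀ ⊗ |det|_𝔸^s`, `s = -Re μ / 4[F:ℚ]` (`exists_heckeCharacter_ideleNorm_cpow`,
`exists_cuspidalAutomorphicRepData_twist_hecke`,
`mulChar_detTwist_apply_posRealScalar_mul_of_cpow_of_eq`) is clean with `A_G` acting by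
`a ↦ a^{i Im μ}`; the hypothesis gives the conclusion for `π₁`, which transfers to
`π₀ = π₁ ⊗ |det|_𝔸^{-s}` (`Kim2003_exteriorSquare_GL4_archimedean.conclusion_of_twist_norm`) and to
`π` (`Kim2003_exteriorSquare_GL4_archimedean.conclusion_of_isNearlyEquivalent`). Borel–Jacquet 1979,
5.7 ("we may assume `π` unitary"); Kim 2003, p. 139.
[cite: Kim2002, §1 p. 139 (convention "cuspidal = unitary cuspidal") and Theorem A] -/
theorem Kim2003_exteriorSquare_GL4_archimedean_of_clean_unitaryCentral
    (H : ∀ (F : Type) [Field F] [NumberField F] (hF : ∀ m : ℕ, isCompact_glFiniteIntegralLevel m F)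
      (π : CuspidalAutomorphicRepData 4 F (hF 4)), π.1.W' = ⊥ →
      (∃ μ : ℂ, μ.re = 0 ∧ ∀ φ ∈ π.1.W, ∀ (t : ℝ≥0ˣ) (g : (AdelicGroupData.gl 4 F).Adelic),
        φ ((show (AdelicGroupData.gl 4 F).Adelic from posRealScalar 4 F t) * g) =
          (((t : ℝ≥0) : ℝ) : ℂ) ^ μ * φ g) →
      ∃ P : AutomorphicRepData (AutomorphyDatum.gl 6 F (hF 6)),
        (∀ᶠ v : HeightOneSpectrum (𝓞 F) in cofinite, ∀ α : Multiset ℂ,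
          π.1.HasSatakeParamAt v α → P.HasSatakeParamAt v (wedgeTwoParams α)) ∧
        (∀ χ : (F →+* ℂ) → Multiset ℂ, π.1.HasArchParameter χ →
          P.HasArchParameter fun σ : F →+* ℂ => wedgeTwoArchParams (χ σ)) ∧
        ∃ (k : ℕ) (m : Fin k → ℕ) (σ : ∀ i : Fin k, CuspidalAutomorphicRepData (m i) F (hF (m i))),
          (∑ i, m i = 6) ∧
          ∀ᶠ v : HeightOneSpectrum (𝓞 F) in cofinite, ∀ β : Fin k → Multiset ℂ,
            (∀ i, (σ i).1.HasSatakeParamAt v (β i)) → P.HasSatakeParamAt v (∑ i, β i)) :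
    Kim2003_exteriorSquare_GL4_archimedean := by
  intro F _ _ hF π
  -- (1) a clean cuspidal model `π₀` with the Satake parameters and the archimedean parameter of `π`
  obtain ⟨π₀, hπ₀, hincl, harch⟩ :=
    CuspidalAutomorphicRepData.exists_clean_hasSatakeParamAt_hasArchParameter_of_sSup_irreducible
      AutomorphicRepsGL.stable_cuspidal_eq_sSup_irreducible_holds π
  have hne : AutomorphicRepData.IsNearlyEquivalent π₀.1 π.1 := by
    filter_upwards [AutomorphicRepData.hasSatakeParamAt_cofinite_holds π₀.1] with v hv
    obtain ⟨β, hβ⟩ := hv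
    exact ⟨β, hβ, hincl v β hβ⟩
  -- (2) `A_G` acts on `π₀` by `a ↦ a^μ`
  obtain ⟨μ, hμ⟩ := π₀.1.exists_apply_posRealScalar_mul_eq_cpow hπ₀
  -- (3) the real norm-power character `‖·‖^s`, `s · 4[F:ℚ] = -Re μ`
  have hd : ((4 * Module.finrank ℚ F : ℕ) : ℝ) ≠ 0 := by
    exact_mod_cast mul_ne_zero four_ne_zero Module.finrank_pos.ne'
  set s : ℝ := -μ.re / ((4 * Module.finrank ℚ F : ℕ) : ℝ) with hsdef
  have hs : ((4 * Module.finrank ℚ F : ℕ) : ℝ) * s = -μ.re := by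
    rw [hsdef, mul_div_cancel₀ _ hd]
  have hν : ((4 * Module.finrank ℚ F : ℕ) : ℂ) * ((s : ℝ) : ℂ) + μ = ((μ.im : ℝ) : ℂ) * Complex.I := by
    have e : ((4 * Module.finrank ℚ F : ℕ) : ℂ) * ((s : ℝ) : ℂ) = ((-μ.re : ℝ) : ℂ) := by
      rw [← hs]
      push_cast
      ring
    rw [e]
    apply Complex.ext <;> simp
  obtain ⟨χ, hχ⟩ := exists_heckeCharacter_ideleNorm_cpow F ((s : ℝ) : ℂ)
  -- (4) the twist `π₁ = π₀ ⊗ (χ ∘ det)`: clean, `A_G` acts by the unitary character `a ↦ a^{i Im μ}`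
  obtain ⟨π₁, hW₁, hW₁'⟩ := exists_cuspidalAutomorphicRepData_twist_hecke χ π₀
  have hπ₁ : π₁.1.W' = ⊥ := by rw [hW₁', hπ₀, Submodule.map_bot]
  have hunit : ∃ ν : ℂ, ν.re = 0 ∧ ∀ φ ∈ π₁.1.W, ∀ (t : ℝ≥0ˣ) (g : (AdelicGroupData.gl 4 F).Adelic),
      φ ((show (AdelicGroupData.gl 4 F).Adelic from posRealScalar 4 F t) * g) =
        (((t : ℝ≥0) : ℝ) : ℂ) ^ ν * φ g := by
    refine ⟨((μ.im : ℝ) : ℂ) * Complex.I, by simp, fun φ hφ t g => ?_⟩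
    rw [hW₁] at hφ
    obtain ⟨φ₀, hφ₀, rfl⟩ := Submodule.mem_map.1 hφ
    exact mulChar_detTwist_apply_posRealScalar_mul_of_cpow_of_eq hχ hν (hμ φ₀ hφ₀) t g
  -- (5) Theorem A for `π₁`, transported back to `π₀ = π₁ ⊗ (χ⁻¹ ∘ det)` and to `π`
  have h₁ := H F hF π₁ hπ₁ hunit
  have hWs : π₀.1.W = π₁.1.W.map (mulChar (detTwist 4 χ⁻¹)) := by
    rw [hW₁, detTwist_inv, map_mulChar_inv_map_mulChar]
  have hW's : π₀.1.W' = π₁.1.W'.map (mulChar (detTwist 4 χ⁻¹)) := by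
    rw [hW₁', detTwist_inv, map_mulChar_inv_map_mulChar]
  exact Kim2003_exteriorSquare_GL4_archimedean.conclusion_of_isNearlyEquivalent F hF hne harch
    (Kim2003_exteriorSquare_GL4_archimedean.conclusion_of_twist_norm F hF
      (inv_apply_eq_ideleNorm_cpow_neg' hχ) hWs hW's h₁)

end Reduction

end Literature.NumberTheory.Automorphic

end
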